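import Literature.Geometry.DiscreteGeometry.DelsarteLinearProgrammingBound

/-!
# Rigidity of the kissing configuration in dimension 8: inner products of a 240-point configuration

Framing: lottery ticket; floor = certified bounds/negative ranges. Venture `PackingBounds`
(cell `pub-packcert`), kissing family, sharp control d = 8, STRUCTURE half.

**Theorem (Bannai–Sloane 1981, first step; Conway–Sloane Ch. 14).** If `C ⊂ S^{7}` is a kissing
configuration (pairwise inner products `≤ 1/2`) with the maximal number `240` of points, then every
inner product of two distinct points of `C` is a root of the sharp LP polynomial
`f(t) = (t + 1) · ((t + 1 / 2) ^ 2 · t ^ 2) · (t - 1 / 2)`, i.e. lies in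
`{-1, -1 / 2, 0, 1 / 2}` — the inner products of the E₈ root system (Bannai–Sloane 1981: the configuration is unique).
Proof: complementary slackness in the Delsarte bound
(`Literature.Geometry.DiscreteGeometry.DelsarteLP.sum_eq_zero_of_card_mul_eq`): `|C| f_0 = f(1)`
holds exactly (`240 · f_0 = f(1)`), so `f(⟨x,y⟩) = 0`; then factor. The remaining steps of the
uniqueness theorem (`C` is a tight spherical design and spans the lattice) are not formalised here.

## References
* E. Bannai, N. J. A. Sloane, *Uniqueness of certain spherical codes*, Canad. J. Math. 33 (1981) 437–449
  (= Conway–Sloane, *SPLAG*, Ch. 14). [`ConwaySloane1999`]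
-/

namespace Summit.Ventures.PackingBounds.Kissing

open Finset Literature.Analysis.SpecialFunctions Literature.Geometry.DiscreteGeometry

/-- **Inner products of a 240-point kissing configuration in `ℝ^8`** lie in
`{-1, -1 / 2, 0, 1 / 2}` (Bannai–Sloane 1981, first step of the uniqueness proof: complementary
slackness for the sharp Delsarte certificate). [cite: ConwaySloane1999, Ch. 14 §§2–3] -/
theorem kissing_dim8_inner_of_card_eq_240 (C : Finset (EuclideanSpace ℝ (Fin 8)))
    (h1 : ∀ x ∈ C, ‖x‖ = 1) (h2 : ∀ x ∈ C, ∀ y ∈ C, x ≠ y → inner ℝ x y ≤ 1 / 2)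
    (hcard : C.card = 240) {x y : EuclideanSpace ℝ (Fin 8)} (hx : x ∈ C) (hy : y ∈ C) (hxy : x ≠ y) :
    inner ℝ x y = -1 ∨
      inner ℝ x y = -1 / 2 ∨
      inner ℝ x y = 0 ∨
      inner ℝ x y = 1 / 2 := by
  have hpoly : ∀ t : ℝ, ∑ k ∈ range (6 + 1),
      (fun k => match k with
      | 0 => 3 / 320 | 1 => 1 / 80 | 2 => 5 / 448 | 3 => 39 / 4480 | 4 => 19 / 3840 | 5 => 1 / 448
      | 6 => 1 / 1792 | _ => 0) k * gegenbauerSum (3 : ℝ) k t =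
      (t + 1) * ((t + 1 / 2) ^ 2 * t ^ 2) * (t - 1 / 2) := by
    intro t
    simp [Finset.sum_range_succ, gegenbauerSum, gegenbauerCoeff, Finset.prod_range_succ,
      Nat.factorial]
    ring
  have h0 := DelsarteLP.sum_eq_zero_of_card_mul_eq (n := 8) (μ := 3) (by norm_num) (by norm_num) 6
    (fun k => match k with
      | 0 => 3 / 320 | 1 => 1 / 80 | 2 => 5 / 448 | 3 => 39 / 4480 | 4 => 19 / 3840 | 5 => 1 / 448
      | 6 => 1 / 1792 | _ => 0)
    ?_ (1 / 2) ?_ C h1 h2 ?_ hx hy hxy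
  · rw [hpoly] at h0
    set t : ℝ := inner ℝ x y with ht
    clear_value t
    have h' : t + 1 = 0 ∨ t + 1 / 2 = 0 ∨ t = 0 ∨ t - 1 / 2 = 0 := by
      rcases mul_eq_zero.1 h0 with h | h
      · rcases mul_eq_zero.1 h with h | h
        · exact Or.inl h
        · rcases mul_eq_zero.1 h with h | h
          · exact Or.inr (Or.inl ((pow_eq_zero_iff two_ne_zero).1 h))
          · exact Or.inr (Or.inr (Or.inl ((pow_eq_zero_iff two_ne_zero).1 h)))
      · exact Or.inr (Or.inr (Or.inr h))
    rcases h' with h | h | h | h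
    · exact Or.inl (by linarith)
    · exact Or.inr (Or.inl (by linarith))
    · exact Or.inr (Or.inr (Or.inl (by linarith)))
    · exact Or.inr (Or.inr (Or.inr (by linarith)))
  · intro k
    split <;> norm_num
  · intro t ht1 ht2
    rw [hpoly]
    exact mul_nonpos_of_nonneg_of_nonpos (mul_nonneg (by linarith) (by positivity)) (by linarith)
  · rw [hcard]
    norm_num [Finset.sum_range_succ, gegenbauerSum, gegenbauerCoeff, Finset.prod_range_succ,
      Nat.factorial]

end Summit.Ventures.PackingBounds.Kissing
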